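import Literature.Analysis.FunctionSpaces.TorusCubeDescentRungFlux
import Literature.Analysis.FluidPDE.PassiveVectorTensorWeightedGalerkinIdentity
import HarnessLib

/-!
# Weak tensor-viscosity passive vectors: the DESCENT LADDER — a block of low modes that starts empty stays
# exponentially empty along a Lipschitz carrier with an exponentially small spectral tail

Analysis/FluidPDE proof-support file (everything proved; no definitions, no named facts).  Setting: `A = 0`, constant tensor
`NearIso 𝔸 lo hi` with `0 ≤ lo` (only `Re⟪X, T_𝔸 X⟫ ≥ 0` is used — the descent needs NO dissipation), datum `w₀ ∈ L²` weakly
divergence free whose Fourier coefficients VANISH on the ladder box `‖k‖_∞ ≤ K₀ + S + 2Δ` (`TorusCubeDescentRungs.ladderSupp`),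
energy bound `‖w(t)‖₂ ≤ M₀` a.e., and carrier slices that are a.e. continuous, weakly divergence free, `Λ`-Lipschitz in the
sense `‖b x − b y‖ ≤ Λ ‖reprc(x − y)‖`, and within `W n` (sup norm) of their Fourier truncations at radius `n S − 2Δ`
(`1 ≤ n ≤ J+1`; `J S ≤ K₀`, `2Δ ≤ S`).

* `ae_le_sq_of_ae_le_mul_setIntegral_sqrt` — the scalar step: `0 ≤ S ≤ B` a.e. and `S(t) ≤ c ∫_{(0,t]} √S` a.e. on `(0,τ)`
  give `S ≤ (cτ)²` a.e. (the essential supremum `y` obeys `y ≤ cτ √y`; no continuity of `S` is needed).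
* `IsWeakTensorPassiveVectorOn.ae_rungEnergy_le_of_datum_off_ladder` — **the descent**: under the LADDER CONDITION
  `4π (K₀ + 2Δ) τ x (2d²Λ/Δ + d Σ_{n ≤ J} W(n+1) x^{n+1}) ≤ 1` (`x ≥ 1`, `τ ≤ T`), for every rung `ℓ ≤ J + 1` and a.e.
  `t ∈ (0,τ)` the rung energy `E_ℓ(w(t)) = Σ_k rungSym_ℓ(k)² |ŵ(t)(k)|²` is at most `M₀² x^{−2ℓ}` — so the modes in the
  cube `‖k‖_∞ ≤ K₀ − J S` carry energy `≤ M₀² x^{−2(J+1)}`: EXPONENTIALLY small in the number of rungs, with a rate set by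
  the Lipschitz constant (one rung per hop, `S ≳ d²Λτ`) and by the spectral tail of the carrier (long hops).

Mechanism: the weighted Galerkin energy identity (`ae_weighted_sum_sq_norm_mFourierCoeff_eq`, weight `rungSym_ℓ²`; the
datum term vanishes, the symbol term is nonnegative) gives `E_ℓ(t) ≤ 2 ∫_{(0,t]} |Flux_ℓ|`; the fixed-time bound
`TorusCubeDescentRungFlux.abs_rungFlux_le` (DiPerna–Lions commutator lemma organised as a frequency ladder: previous rung
through the cube commutator, farther rungs through the tail) and the induction hypothesis for the lower rungs give
`|Flux_ℓ| ≤ (c_ℓ/2) √E_ℓ` with `c_ℓ τ ≤ M₀ x^{−ℓ}` by the ladder condition; the scalar step closes the induction.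
Consumer: cell `ad-ideate`, K1L_D `stmt-AnomalousDissipation-27980`, W3-E (ii) `stub_effectiveFrameEnergyL_bandKill`
(band-kill / leakage estimate for the frozen-frame propagator, F-k3l-7): with the analytic spectral tail of the Lagrangian
carrier (`TorusDnormFourierTail`) the long-hop sum is geometric and `J ∼ c₃/θ` rungs fit in a window.
## Mathlib / tree search
Tree: `PassiveVectorTensorWeightedGalerkinIdentity` (`ae_weighted_sum_sq_norm_mFourierCoeff_eq`, `integrableOn_weightedFlux`),
`PassiveVectorTensorGalerkinIdentity.ae_re_inner_symbT_nonneg`, `PassiveVectorTensorModeEnergy.integrableOn_norm_sq_mFourierCoeff`,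
`PassiveVectorTensorSlowLeakage` (the one-block, bounded-carrier companion with polynomial leakage), `TorusCubeDescentRungFlux`.
Mathlib: `ENNReal.ae_le_essSup`, `essSup_le_of_ae_le`, `IntegrableOn.of_bound`, `integral_mono_ae`, `Real.volume_real_Ioc_of_le`.
## References
* R. J. DiPerna, P.-L. Lions, Invent. Math. 98 (1989), §II.1 Lemma II.1. [`DiPernaLions1989`]
* R. Temam, *Navier–Stokes Equations* (1984), Ch. III §1 Lemma 1.2. [`Temam1984`]
* J. C. Robinson, J. L. Rodrigo, W. Sadowski, *The three-dimensional Navier–Stokes equations* (2016), §4.2 (4.20). [`RobinsonRodrigoSadowski2016`] -/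

noncomputable section

open MeasureTheory Set Filter Complex UnitAddTorus Function Finset
open scoped ENNReal InnerProductSpace ComplexConjugate

/-! ## The scalar step and the descent ladder in time -/

namespace Literature.Analysis.FluidPDE

namespace Torus

variable {d : Type*} [Fintype d] [DecidableEq d]

/-- **Scalar step of the descent** (a square-root Bihari inequality without continuity): if `0 ≤ S ≤ B` a.e. on `(0,τ)`
and `S(t) ≤ c ∫_{(0,t]} √S` for a.e. `t ∈ (0,τ)`, then `S ≤ (cτ)²` a.e. on `(0,τ)` — the essential supremum `y` obeys
`y ≤ cτ√y`. [cite: Temam1984, Ch. III §1 Lemma 1.2] -/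
theorem ae_le_sq_of_ae_le_mul_setIntegral_sqrt {τ c B : ℝ} (hc : 0 ≤ c) (hτ : 0 ≤ τ) {S : ℝ → ℝ}
    (hSm : AEStronglyMeasurable S (volume.restrict (Ioo 0 τ)))
    (hSB : ∀ᵐ t ∂(volume.restrict (Ioo 0 τ)), S t ≤ B)
    (hS : ∀ᵐ t ∂(volume.restrict (Ioo 0 τ)), S t ≤ c * ∫ s in Ioc 0 t, Real.sqrt (S s)) :
    ∀ᵐ t ∂(volume.restrict (Ioo 0 τ)), S t ≤ (c * τ) ^ 2 := by
  set μ := volume.restrict (Ioo (0:ℝ) τ) with hμ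
  set Bs : ℝ≥0∞ := essSup (fun t => ENNReal.ofReal (S t)) μ with hBs
  have hBs_le : Bs ≤ ENNReal.ofReal B :=
    essSup_le_of_ae_le _ (by filter_upwards [hSB] with t ht using ENNReal.ofReal_le_ofReal ht)
  have hBs_fin : Bs ≠ ⊤ := ne_top_of_le_ne_top ENNReal.ofReal_ne_top hBs_le
  set y : ℝ := Bs.toReal with hy
  have hy0 : 0 ≤ y := ENNReal.toReal_nonneg
  have hSy : ∀ᵐ t ∂μ, S t ≤ y := by
    filter_upwards [ENNReal.ae_le_essSup fun t => ENNReal.ofReal (S t)] with t ht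
    exact (ENNReal.ofReal_le_iff_le_toReal hBs_fin).1 ht
  have hSy' := (ae_restrict_iff' (measurableSet_Ioo : MeasurableSet (Ioo (0:ℝ) τ))).1 hSy
  have hSm' : AEStronglyMeasurable (fun s => Real.sqrt (S s)) μ := Real.continuous_sqrt.comp_aestronglyMeasurable hSm
  -- `S ≤ c τ √y` a.e.
  have hkey : ∀ᵐ t ∂μ, S t ≤ c * τ * Real.sqrt y := by
    filter_upwards [hS, ae_restrict_mem (measurableSet_Ioo : MeasurableSet (Ioo (0:ℝ) τ))] with t ht htI
    have hsub : Ioc 0 t ⊆ Ioo 0 τ := fun s hs => ⟨hs.1, lt_of_le_of_lt hs.2 htI.2⟩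
    have hfin : volume (Ioc (0:ℝ) t) < ⊤ := by rw [Real.volume_Ioc]; exact ENNReal.ofReal_lt_top
    have hmeas : AEStronglyMeasurable (fun s => Real.sqrt (S s)) (volume.restrict (Ioc 0 t)) :=
      hSm'.mono_measure (Measure.restrict_mono hsub le_rfl)
    have hbound : ∀ᵐ s ∂(volume.restrict (Ioc 0 t)), Real.sqrt (S s) ≤ Real.sqrt y :=
      (ae_restrict_iff' measurableSet_Ioc).2 (hSy'.mono fun s hs hsI => Real.sqrt_le_sqrt (hs (hsub hsI)))
    have hint1 : IntegrableOn (fun s => Real.sqrt (S s)) (Ioc 0 t) volume :=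
      IntegrableOn.of_bound hfin hmeas (Real.sqrt y) (hbound.mono fun s hs => by
        rw [Real.norm_eq_abs, abs_of_nonneg (Real.sqrt_nonneg _)]; exact hs)
    have hint2 : IntegrableOn (fun _ => Real.sqrt y) (Ioc 0 t) volume := integrableOn_const hfin.ne
    have hint : ∫ s in Ioc 0 t, Real.sqrt (S s) ≤ ∫ _ in Ioc (0:ℝ) t, Real.sqrt y := integral_mono_ae hint1 hint2 hbound
    rw [setIntegral_const, Real.volume_real_Ioc_of_le htI.1.le, sub_zero, smul_eq_mul] at hint
    calc S t ≤ c * ∫ s in Ioc 0 t, Real.sqrt (S s) := ht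
      _ ≤ c * (t * Real.sqrt y) := mul_le_mul_of_nonneg_left hint hc
      _ ≤ c * (τ * Real.sqrt y) := mul_le_mul_of_nonneg_left (mul_le_mul_of_nonneg_right htI.2.le (Real.sqrt_nonneg _)) hc
      _ = c * τ * Real.sqrt y := by ring
  -- hence `y ≤ c τ √y`, so `y ≤ (cτ)²`
  have hyle : y ≤ c * τ * Real.sqrt y := by
    have h1 : Bs ≤ ENNReal.ofReal (c * τ * Real.sqrt y) :=
      essSup_le_of_ae_le _ (hkey.mono fun t ht => ENNReal.ofReal_le_ofReal ht)
    exact ENNReal.toReal_le_of_le_ofReal (by positivity) h1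
  have hy2 : y ≤ (c * τ) ^ 2 := by
    have hs := Real.mul_self_sqrt hy0
    rcases eq_or_lt_of_le (Real.sqrt_nonneg y) with h0 | hpos
    · rw [← hs, ← h0, mul_zero]; positivity
    · have h2 : Real.sqrt y ≤ c * τ := by
        have : Real.sqrt y * Real.sqrt y ≤ c * τ * Real.sqrt y := by rw [hs]; exact hyle
        exact le_of_mul_le_mul_right this hpos
      calc y = Real.sqrt y * Real.sqrt y := hs.symm
        _ ≤ (c * τ) * (c * τ) := mul_le_mul h2 h2 (Real.sqrt_nonneg _) (by positivity)
        _ = (c * τ) ^ 2 := by ring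
  filter_upwards [hSy] with t ht
  exact ht.trans hy2

namespace IsWeakTensorPassiveVectorOn

/-- **THE DESCENT LADDER (spectral version of the DiPerna–Lions commutator lemma) for weak tensor-viscosity passive
vectors.**  `A = 0`, `NearIso 𝔸 lo hi` with `0 ≤ lo`; datum `w₀ ∈ L²` weakly divergence free whose Fourier coefficients
VANISH on the ladder box `‖k‖_∞ ≤ K₀ + S + 2Δ`; energy bound `‖w(t)‖₂ ≤ M₀` a.e.; carrier slices a.e. continuous, weakly
divergence free, `Λ`-Lipschitz (`‖b x − b y‖ ≤ Λ‖FunctionSpaces.Torus.reprc(x−y)‖`) and within `W n` (sup norm) of their Fourier truncations at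
radius `n S − 2Δ`, `1 ≤ n ≤ J + 1` (`J S ≤ K₀`, `2Δ ≤ S`).  If the LADDER CONDITION
`4π (K₀ + 2Δ) τ x (2d²Λ/Δ + d Σ_{n ≤ J} W(n+1) x^{n+1}) ≤ 1` holds (`x ≥ 1`, `τ ≤ T`), then every rung energy decays
geometrically down the ladder: for `ℓ ≤ J + 1` and a.e. `t ∈ (0,τ)`,
`E_ℓ(w(t)) = Σ_k rungSym_ℓ(k)² |ŵ(t)(k)|² ≤ M₀² x^{−2ℓ}`; in particular the modes in the cube `‖k‖_∞ ≤ K₀ − J S` carry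
energy at most `M₀² x^{−2(J+1)}`.  [cite: DiPernaLions1989, §II.1 Lemma II.1] [cite: Temam1984, Ch. III §1 Lemma 1.2] -/
theorem ae_rungEnergy_le_of_datum_off_ladder {T : ℝ} {𝔸 : Visc4 d} {b w : ℝ → UnitAddTorus d → EuclideanSpace ℝ d}
    {w₀ : UnitAddTorus d → EuclideanSpace ℝ d} (h : IsWeakTensorPassiveVectorOn 0 T 𝔸 b w₀ w)
    {lo hi : ℝ} (h𝔸 : NearIso 𝔸 lo hi) (hlo : 0 ≤ lo)
    (hw₀ : MemLp w₀ 2 volume) (hdiv₀ : FunctionSpaces.Torus.IsWeaklyDivFree w₀)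
    {M₀ : ℝ} (hM₀ : 0 ≤ M₀) (hE : ∀ᵐ t ∂(volume.restrict (Ioo 0 T)), ∫ x, ‖w t x‖ ^ 2 ≤ M₀ ^ 2)
    {K₀ S Δ J : ℕ} (hΔ : 0 < Δ) (hS : 2 * Δ ≤ S) (hJ : (J + 1) * S ≤ K₀ + S)
    (hoff : ∀ k ∈ FunctionSpaces.Torus.ladderSupp d K₀ S Δ, mFourierCoeff (FunctionSpaces.EuclideanSpace.complexify ∘ w₀) k = 0)
    (hbc : ∀ᵐ s ∂(volume.restrict (Ioo 0 T)), Continuous (b s))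
    {Λ : ℝ} (hΛ : 0 ≤ Λ) (hbL : ∀ᵐ s ∂(volume.restrict (Ioo 0 T)), ∀ x y, ‖b s x - b s y‖ ≤ Λ * ‖FunctionSpaces.Torus.reprc (x - y)‖)
    {W : ℕ → ℝ} (hW0 : ∀ n, 0 ≤ W n)
    (hW : ∀ᵐ s ∂(volume.restrict (Ioo 0 T)), ∀ n, 1 ≤ n → n ≤ J + 1 → ∀ x,
      ‖b s x - FunctionSpaces.Torus.fourierTruncate (n * S - 2 * Δ) (b s) x‖ ≤ W n)
    {τ x : ℝ} (hτ : 0 ≤ τ) (hτT : τ ≤ T) (hx : 1 ≤ x)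
    (hladder : 4 * Real.pi * (K₀ + 2 * Δ) * τ * x *
      (2 * (Fintype.card d) ^ 2 * Λ / Δ + Fintype.card d * ∑ n ∈ Finset.range (J + 1), W (n + 1) * x ^ (n + 1)) ≤ 1) :
    ∀ ℓ, ℓ ≤ J + 1 → ∀ᵐ t ∂(volume.restrict (Ioo 0 τ)), FunctionSpaces.Torus.rungEnergy K₀ S Δ ℓ (w t) ≤ M₀ ^ 2 * (x⁻¹ ^ ℓ) ^ 2 := by
  classical
  -- ### notation
  set F : Finset (d → ℤ) := FunctionSpaces.Torus.ladderSupp d K₀ S Δ with hF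
  set X : ℝ → (d → ℤ) → EuclideanSpace ℂ d := fun s => mFourierCoeff (FunctionSpaces.EuclideanSpace.complexify ∘ w s) with hX
  set E : ℕ → ℝ → ℝ := fun ℓ s => FunctionSpaces.Torus.rungEnergy K₀ S Δ ℓ (w s) with hEdef
  set FL : ℕ → ℝ → ℝ := fun ℓ s => ∫ y, ⟪w s y, FunctionSpaces.Torus.convect (b s)
    (FunctionSpaces.Torus.realTrigPoly F (fun k => (((FunctionSpaces.Torus.rungSym K₀ S Δ ℓ k) ^ 2 : ℝ) : ℂ) • X s k)) y⟫_ℝ with hFL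
  set Γ : ℝ := 2 * (Fintype.card d) ^ 2 * Λ / Δ + Fintype.card d * ∑ n ∈ Finset.range (J + 1), W (n + 1) * x ^ (n + 1) with hΓ
  have hx0 : 0 < x := by linarith
  have hxi0 : 0 ≤ x⁻¹ := inv_nonneg.2 hx0.le
  have hΓ0 : 0 ≤ Γ := by
    have : 0 ≤ ∑ n ∈ Finset.range (J + 1), W (n + 1) * x ^ (n + 1) :=
      Finset.sum_nonneg fun n _ => mul_nonneg (hW0 _) (pow_nonneg hx0.le _)
    positivity
  have hsubT : Ioo (0:ℝ) τ ⊆ Ioo 0 T := Ioo_subset_Ioo le_rfl hτT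
  have hres : ∀ {P : ℝ → Prop}, (∀ᵐ s ∂(volume.restrict (Ioo 0 T)), P s) → ∀ᵐ s ∂(volume.restrict (Ioo 0 τ)), P s :=
    fun hP => ae_restrict_of_ae_restrict_of_subset hsubT hP
  -- ### measurability / integrability of the rung energies and fluxes
  have hEeq : ∀ ℓ s, E ℓ s = ∑ k ∈ F, FunctionSpaces.Torus.rungSym K₀ S Δ ℓ k ^ 2 * ‖X s k‖ ^ 2 := fun ℓ s => FunctionSpaces.Torus.rungEnergy_eq_sum_mul ℓ (w s)
  have hEint : ∀ ℓ, IntegrableOn (E ℓ) (Ioo 0 T) volume := by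
    intro ℓ
    have : IntegrableOn (fun s => ∑ k ∈ F, FunctionSpaces.Torus.rungSym K₀ S Δ ℓ k ^ 2 * ‖X s k‖ ^ 2) (Ioo 0 T) volume :=
      integrable_finsetSum _ fun k _ => (h.integrableOn_norm_sq_mFourierCoeff k).const_mul _
    exact this.congr_fun (fun s _ => (hEeq ℓ s).symm) measurableSet_Ioo
  have hEm : ∀ ℓ, AEStronglyMeasurable (E ℓ) (volume.restrict (Ioo 0 τ)) :=
    fun ℓ => ((hEint ℓ).mono_set hsubT).aestronglyMeasurable
  have hE0 : ∀ ℓ s, 0 ≤ E ℓ s := fun ℓ s => FunctionSpaces.Torus.rungEnergy_nonneg ℓ (w s)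
  -- the weighted test field in the two forms
  have hconv : ∀ ℓ s, (fun y => ∑ k ∈ F, (FunctionSpaces.Torus.rungSym K₀ S Δ ℓ k ^ 2) • FunctionSpaces.Torus.realTrigPoly {k} (fun k' => X s k') y) =
      FunctionSpaces.Torus.realTrigPoly F (fun k => (((FunctionSpaces.Torus.rungSym K₀ S Δ ℓ k) ^ 2 : ℝ) : ℂ) • X s k) :=
    fun ℓ s => FunctionSpaces.Torus.sum_smul_realTrigPoly_singleton F (fun k => FunctionSpaces.Torus.rungSym K₀ S Δ ℓ k ^ 2) (X s)
  have hFLint : ∀ ℓ, IntegrableOn (FL ℓ) (Ioo 0 T) volume := by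
    intro ℓ
    have hi := h.integrableOn_weightedFlux F (fun k => FunctionSpaces.Torus.rungSym K₀ S Δ ℓ k ^ 2)
    refine hi.congr_fun (fun s _ => ?_) measurableSet_Ioo
    simp only [zero_mul, add_zero, hFL, hX]
    rw [← hconv ℓ s]
  -- ### STEP 1: the weighted energy identity ⇒ `E_ℓ(t) ≤ 2 ∫_{(0,t]} |FL_ℓ|`
  have hstep1 : ∀ ℓ, ∀ᵐ t ∂(volume.restrict (Ioo 0 T)), E ℓ t ≤ 2 * ∫ s in Ioc 0 t, |FL ℓ s| := by
    intro ℓ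
    have hnn := h.ae_re_inner_symbT_nonneg h𝔸 hlo
    have hnn' := (ae_restrict_iff' (measurableSet_Ioo : MeasurableSet (Ioo (0:ℝ) T))).1 hnn
    filter_upwards [h.ae_weighted_sum_sq_norm_mFourierCoeff_eq hw₀ hdiv₀,
      ae_restrict_mem (measurableSet_Ioo : MeasurableSet (Ioo (0:ℝ) T))] with t ht htT
    have hid := ht F (fun k => FunctionSpaces.Torus.rungSym K₀ S Δ ℓ k ^ 2)
    have hsub : Ioc 0 t ⊆ Ioo 0 T := fun s hs => ⟨hs.1, lt_of_le_of_lt hs.2 htT.2⟩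
    -- the datum term vanishes
    have h0 : ∑ k ∈ F, FunctionSpaces.Torus.rungSym K₀ S Δ ℓ k ^ 2 * ‖mFourierCoeff (FunctionSpaces.EuclideanSpace.complexify ∘ w₀) k‖ ^ 2 = 0 :=
      Finset.sum_eq_zero fun k hk => by rw [hoff k hk, norm_zero]; ring
    -- the dissipation term is nonnegative
    have hD : 0 ≤ ∫ s in Ioc 0 t, 4 * Real.pi ^ 2 * ∑ k ∈ F, FunctionSpaces.Torus.rungSym K₀ S Δ ℓ k ^ 2 *
        (⟪mFourierCoeff (FunctionSpaces.EuclideanSpace.complexify ∘ w s) k,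
          symbT 𝔸 k (mFourierCoeff (FunctionSpaces.EuclideanSpace.complexify ∘ w s) k)⟫_ℂ).re := by
      refine setIntegral_nonneg_of_ae_restrict ((ae_restrict_iff' measurableSet_Ioc).2 (hnn'.mono fun s hs hsI => ?_))
      have := hs (hsub hsI)
      exact mul_nonneg (by positivity) (Finset.sum_nonneg fun k _ => mul_nonneg (sq_nonneg _) (this k))
    -- the flux term in the `FunctionSpaces.Torus.realTrigPoly` form
    have hfl : ∫ s in Ioc 0 t, ((∫ y, ⟪w s y, FunctionSpaces.Torus.convect (b s) (fun y => ∑ k ∈ F, (FunctionSpaces.Torus.rungSym K₀ S Δ ℓ k ^ 2) •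
          FunctionSpaces.Torus.realTrigPoly {k} (fun k' => mFourierCoeff (FunctionSpaces.EuclideanSpace.complexify ∘ w s) k') y) y⟫_ℝ) +
        0 * ∫ y, ⟪b s y, FunctionSpaces.Torus.convect (w s) (fun y => ∑ k ∈ F, (FunctionSpaces.Torus.rungSym K₀ S Δ ℓ k ^ 2) •
          FunctionSpaces.Torus.realTrigPoly {k} (fun k' => mFourierCoeff (FunctionSpaces.EuclideanSpace.complexify ∘ w s) k') y) y⟫_ℝ) =
        ∫ s in Ioc 0 t, FL ℓ s := by
      refine setIntegral_congr_fun measurableSet_Ioc fun s _ => ?_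
      simp only [zero_mul, add_zero, hFL, hX]
      rw [← hconv ℓ s]
    have habs : ∫ s in Ioc 0 t, FL ℓ s ≤ ∫ s in Ioc 0 t, |FL ℓ s| :=
      integral_mono_ae ((hFLint ℓ).mono_set hsub) ((hFLint ℓ).mono_set hsub).abs (ae_of_all _ fun s => le_abs_self _)
    have hEt : E ℓ t = ∑ k ∈ F, FunctionSpaces.Torus.rungSym K₀ S Δ ℓ k ^ 2 * ‖mFourierCoeff (FunctionSpaces.EuclideanSpace.complexify ∘ w t) k‖ ^ 2 := hEeq ℓ t
    rw [h0, hfl] at hid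
    linarith
  -- ### STEP 2: induction down the ladder
  suffices hind : ∀ ℓ, ℓ ≤ J + 1 → ∀ i, i ≤ ℓ → ∀ᵐ t ∂(volume.restrict (Ioo 0 τ)), E i t ≤ M₀ ^ 2 * (x⁻¹ ^ i) ^ 2 from
    fun ℓ hℓ => hind ℓ hℓ ℓ le_rfl
  intro ℓ
  induction ℓ with
  | zero =>
    intro _ i hi
    obtain rfl : i = 0 := Nat.le_zero.1 hi
    filter_upwards [hres hE, hres h.ae_memLp_two] with t ht h2
    simp only [pow_zero, one_pow, mul_one]
    exact (FunctionSpaces.Torus.rungEnergy_le_integral_norm_sq 0 h2).trans ht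
  | succ ℓ ih =>
    intro hℓJ i hi
    have ih' := ih (Nat.le_of_succ_le hℓJ)
    rcases Nat.lt_or_ge i (ℓ + 1) with hlt | hge
    · exact ih' i (Nat.lt_succ_iff.1 hlt)
    obtain rfl : i = ℓ + 1 := le_antisymm hi hge
    -- all lower rungs at once, a.e. in `s ∈ (0,τ)`
    have hlow : ∀ᵐ s ∂(volume.restrict (Ioo 0 τ)), ∀ i, i ≤ ℓ → E i s ≤ M₀ ^ 2 * (x⁻¹ ^ i) ^ 2 := by
      refine ae_all_iff.2 fun i => ?_
      by_cases hi : i ≤ ℓ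
      · filter_upwards [ih' i hi] with s hs; exact fun _ => hs
      · exact ae_of_all _ fun s hi' => absurd hi' hi
    -- geometry of rung `ℓ + 1`
    have hℓS : (ℓ + 1) * S ≤ K₀ + S := le_trans (Nat.mul_le_mul_right _ hℓJ) hJ
    set H : ℕ := FunctionSpaces.Torus.rungHeight K₀ S (ℓ + 1) with hH
    have hHK : (H : ℝ) ≤ K₀ := by exact_mod_cast FunctionSpaces.Torus.rungHeight_succ_le (K₀ := K₀) (S := S) ℓ
    set c : ℝ := 4 * Real.pi * (H + 2 * Δ) * (M₀ * x⁻¹ ^ ℓ * Γ) with hc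
    have hc0 : 0 ≤ c := by positivity
    -- ### the a.e.-in-`s` flux bound `|FL_{ℓ+1}(s)| ≤ (c/2) √E_{ℓ+1}(s)` on `(0,τ)`
    have hflux : ∀ᵐ s ∂(volume.restrict (Ioo 0 τ)), |FL (ℓ + 1) s| ≤ c / 2 * Real.sqrt (E (ℓ + 1) s) := by
      filter_upwards [hlow, hres hbc, hres hbL, hres hW, hres h.ae_isWeaklyDivFree_carrier, hres h.ae_memLp_two,
        hres hE] with s hlow_s hbc_s hbL_s hW_s hdiv_s h2_s hE_s
      have hfix := FunctionSpaces.Torus.abs_rungFlux_le (K₀ := K₀) hΔ hS (Nat.le_add_left 1 ℓ) hℓS hbc_s hdiv_s hΛ hbL_s h2_s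
        (W := W) (fun n hn hnℓ y => hW_s n hn (hnℓ.trans hℓJ) y)
      simp only [Nat.add_sub_cancel] at hfix
      have hbr := FunctionSpaces.Torus.ladder_bracket_le (Nat.succ_le_succ_iff.1 hℓJ) hx hM₀
        (show (0:ℝ) ≤ 2 * (Fintype.card d) ^ 2 * Λ / Δ by positivity) (Nat.cast_nonneg (Fintype.card d)) hW0
        (e := fun i => Real.sqrt (E i s)) (fun i hi => ?_) (e' := Real.sqrt (∫ y, ‖w s y‖ ^ 2)) ?_
      rotate_left
      · calc Real.sqrt (E i s) ≤ Real.sqrt (M₀ ^ 2 * (x⁻¹ ^ i) ^ 2) := Real.sqrt_le_sqrt (hlow_s i hi)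
          _ = M₀ * x⁻¹ ^ i := by rw [← mul_pow, Real.sqrt_sq (mul_nonneg hM₀ (pow_nonneg hxi0 _))]
      · calc Real.sqrt (∫ y, ‖w s y‖ ^ 2) ≤ Real.sqrt (M₀ ^ 2) := Real.sqrt_le_sqrt hE_s
          _ = M₀ := Real.sqrt_sq hM₀
      have hsq0 : 0 ≤ Real.sqrt (E (ℓ + 1) s) := Real.sqrt_nonneg _
      have hHΔ : (0:ℝ) ≤ 2 * Real.pi * (H + 2 * Δ) := by positivity
      calc |FL (ℓ + 1) s| ≤ 2 * Real.pi * (H + 2 * Δ) * Real.sqrt (E (ℓ + 1) s) *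
            (2 * (Fintype.card d) ^ 2 * Λ / Δ * Real.sqrt (E ℓ s) +
              Fintype.card d * ∑ i ∈ Finset.range ℓ, W (ℓ - i) * Real.sqrt (E i s) +
              Fintype.card d * W (ℓ + 1) * Real.sqrt (∫ y, ‖w s y‖ ^ 2)) := hfix
        _ ≤ 2 * Real.pi * (H + 2 * Δ) * Real.sqrt (E (ℓ + 1) s) * (M₀ * x⁻¹ ^ ℓ * Γ) := by
            refine mul_le_mul_of_nonneg_left ?_ (mul_nonneg hHΔ hsq0)
            rw [← hΓ] at hbr
            exact hbr
        _ = c / 2 * Real.sqrt (E (ℓ + 1) s) := by rw [hc]; ring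
    -- ### integrate: `E_{ℓ+1}(t) ≤ c ∫_{(0,t]} √E_{ℓ+1}` a.e. on `(0,τ)`
    have hflux' := (ae_restrict_iff' (measurableSet_Ioo : MeasurableSet (Ioo (0:ℝ) τ))).1 hflux
    have hEB : ∀ᵐ t ∂(volume.restrict (Ioo 0 τ)), E (ℓ + 1) t ≤ M₀ ^ 2 := by
      filter_upwards [hres hE, hres h.ae_memLp_two] with t ht h2
      exact (FunctionSpaces.Torus.rungEnergy_le_integral_norm_sq (ℓ + 1) h2).trans ht
    have hEB' := (ae_restrict_iff' (measurableSet_Ioo : MeasurableSet (Ioo (0:ℝ) τ))).1 hEB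
    have hSm' : AEStronglyMeasurable (fun s => Real.sqrt (E (ℓ + 1) s)) (volume.restrict (Ioo 0 τ)) :=
      Real.continuous_sqrt.comp_aestronglyMeasurable (hEm (ℓ + 1))
    have hstep : ∀ᵐ t ∂(volume.restrict (Ioo 0 τ)), E (ℓ + 1) t ≤ c * ∫ s in Ioc 0 t, Real.sqrt (E (ℓ + 1) s) := by
      filter_upwards [hres (hstep1 (ℓ + 1)), ae_restrict_mem (measurableSet_Ioo : MeasurableSet (Ioo (0:ℝ) τ))]
        with t ht htI
      have hsub : Ioc 0 t ⊆ Ioo 0 τ := fun s hs => ⟨hs.1, lt_of_le_of_lt hs.2 htI.2⟩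
      have hsub' : Ioc 0 t ⊆ Ioo 0 T := hsub.trans hsubT
      have hfin : volume (Ioc (0:ℝ) t) < ⊤ := by rw [Real.volume_Ioc]; exact ENNReal.ofReal_lt_top
      have hi1 : IntegrableOn (fun s => |FL (ℓ + 1) s|) (Ioc 0 t) volume := ((hFLint (ℓ + 1)).mono_set hsub').abs
      have hi2 : IntegrableOn (fun s => c / 2 * Real.sqrt (E (ℓ + 1) s)) (Ioc 0 t) volume := by
        refine IntegrableOn.of_bound hfin ((hSm'.mono_measure (Measure.restrict_mono hsub le_rfl)).const_mul _)
          (c / 2 * M₀) ((ae_restrict_iff' measurableSet_Ioc).2 (hEB'.mono fun s hs hsI => ?_))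
        rw [Real.norm_eq_abs, abs_of_nonneg (by positivity)]
        refine mul_le_mul_of_nonneg_left ?_ (by positivity)
        calc Real.sqrt (E (ℓ + 1) s) ≤ Real.sqrt (M₀ ^ 2) := Real.sqrt_le_sqrt (hs (hsub hsI))
          _ = M₀ := Real.sqrt_sq hM₀
      have hmono : ∫ s in Ioc 0 t, |FL (ℓ + 1) s| ≤ ∫ s in Ioc 0 t, c / 2 * Real.sqrt (E (ℓ + 1) s) :=
        integral_mono_ae hi1 hi2 ((ae_restrict_iff' measurableSet_Ioc).2 (hflux'.mono fun s hs hsI => hs (hsub hsI)))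
      rw [integral_const_mul] at hmono
      calc E (ℓ + 1) t ≤ 2 * ∫ s in Ioc 0 t, |FL (ℓ + 1) s| := ht
        _ ≤ 2 * (c / 2 * ∫ s in Ioc 0 t, Real.sqrt (E (ℓ + 1) s)) := by linarith
        _ = c * ∫ s in Ioc 0 t, Real.sqrt (E (ℓ + 1) s) := by ring
    -- ### the scalar step and the ladder condition
    have hfinal := ae_le_sq_of_ae_le_mul_setIntegral_sqrt hc0 hτ (hEm (ℓ + 1)) hEB hstep
    have hcτ : c * τ ≤ M₀ * x⁻¹ ^ (ℓ + 1) := by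
      -- `c τ = 4π(H+2Δ) τ Γ · M₀ x^{-ℓ}` and `4π(H+2Δ) τ Γ x ≤ 4π(K₀+2Δ) τ x Γ ≤ 1`
      have h1 : 4 * Real.pi * (H + 2 * Δ) * τ * x * Γ ≤ 1 := by
        calc 4 * Real.pi * (H + 2 * Δ) * τ * x * Γ ≤ 4 * Real.pi * (K₀ + 2 * Δ) * τ * x * Γ := by
              have : (0:ℝ) ≤ 4 * Real.pi := by positivity
              have hτxΓ : 0 ≤ τ * x * Γ := by positivity
              nlinarith [mul_nonneg (mul_nonneg this hτxΓ) (sub_nonneg.2 hHK)]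
          _ ≤ 1 := hladder
      have hMx : 0 ≤ M₀ * x⁻¹ ^ (ℓ + 1) := by positivity
      calc c * τ = (4 * Real.pi * (H + 2 * Δ) * τ * x * Γ) * (M₀ * x⁻¹ ^ (ℓ + 1)) := by
            rw [hc, pow_succ]; field_simp
        _ ≤ 1 * (M₀ * x⁻¹ ^ (ℓ + 1)) := mul_le_mul_of_nonneg_right h1 hMx
        _ = _ := one_mul _
    filter_upwards [hfinal] with t ht
    calc E (ℓ + 1) t ≤ (c * τ) ^ 2 := ht
      _ ≤ (M₀ * x⁻¹ ^ (ℓ + 1)) ^ 2 := pow_le_pow_left₀ (by positivity) hcτ 2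
      _ = M₀ ^ 2 * (x⁻¹ ^ (ℓ + 1)) ^ 2 := by ring

end IsWeakTensorPassiveVectorOn

end Torus

end Literature.Analysis.FluidPDE

end
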